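import Literature.Barriers.CriticalPhenomena.PositionSpaceRGNonGibbsianSelection
import Literature.Probability.LatticeModels.GriffithsMonotonicity
import Literature.Probability.LatticeModels.GriffithsKellySherman
import Literature.Probability.LatticeModels.DoubleCurrents
import Literature.Probability.LatticeModels.TorusZeroMode
import Literature.Probability.LatticeModels.CriticalTwoPointLower
import HarnessLib

/-!
# Barrier `PositionSpaceRGNonGibbsian` (van Enter–Fernández–Sokal 1993, Theorem 4.2), layer 4a:
# discharge of `VEFS1993_step24` — the `+` phase of the diluted internal-spin system is magnetised
# (Step 1 with Step 2.4), by Griffiths' comparison with the `(d-1)`-dimensional model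

Fifth companion file of `Literature/Barriers/CriticalPhenomena/PositionSpaceRGNonGibbsian.lean`, on
the line of Theorem 4.2. `PositionSpaceRGNonGibbsianSelection.lean` reduced the uniform
finite-volume estimate `VEFS1993_eq413` to the named facts `VEFS1993_step2` (phase selection) and
`VEFS1993_step24` (magnetisation of the internal `+` phase at the neighbours of the origin). Here
`VEFS1993_step24` is PROVED (`VEFS1993_step24_holds`), following the printed Step 1 of §4.3.1:
"the diluted system is a collection of `(d-1)`-dimensional diluted and undiluted Ising models,
ferromagnetically coupled. In particular, the `d`-dimensional diluted system is more ferromagnetic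
than the `(d-1)`-dimensional undiluted Ising model, and hence exhibits spontaneous magnetization
for all temperatures below the critical temperature `J_{c,d-1}` of the `(d-1)`-dimensional
undiluted Ising model."

## The proof

For `d = n + 1`, a neighbour `y = s e_i` (`s = ±1`) of the origin and `L ≥ 1`:
`⟨σ_y⟩⁺_{dec; Λ^int_L} ≥ ⟨σ_y⟩⁺_{slice; Λ^int_L}` by **Griffiths monotonicity in the graph for the
`+` boundary condition** (`isingCorr_plus_mono_graph`, proved here from the tree's GKS II: removing
the edges off the hyperplane `{y_i = s}` of internal sites removes nonnegative couplings and
fields); `= ⟨σ_y⟩⁺_{slice; image of box n (2L)}` (the other sites are isolated,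
`isingExpect_fixed_eq_of_separated`); `= ⟨σ_0⟩⁺_{ℤ^n; box n (2L)}` (transport along the slice
embedding `x' ↦ (x' with s inserted at i)`, a local isomorphism, `isingExpect_plus_map_spinAt`);
`≥ m*_n(β)` (the `+` one-point function decreases to the spontaneous magnetisation:
`isingCorr_plus_le_of_subset`, `hasBoxLimit_isingCorr_plus_holds`); and `m*_n(β) > 0` for
`β > β_c(n)`, `n ≥ 2` (`spontaneousMagnetization_pos_of_criticalBeta_lt_holds`, Peierls). For
`L = 0` the volume is empty and `⟨σ_y⟩⁺ = 1 ≥ m*`.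

## What is formalised

* `Literature.Probability.LatticeModels.isingCorr_plus_mono_graph` (GKS II consequence, `+`
  boundary condition; the free-boundary version is the tree's `isingCorr_free_mono_graph`), with
  the tilt identity `isingExpect_plus_mul_of_le`; `isingExpect_plus_empty_spinAt`.
* The slice embeddings `sliceEmb n i s`, slice graphs `sliceGraph n i s` and their local-isomorphism
  properties; `isingExpect_box_le_decorated`; `spontaneousMagnetization_le_isingExpect_box`.
* `VEFS1993_step24_holds : VEFS1993_step24`.
-/

noncomputable section

open MeasureTheory Finset Filter Topology
open scoped symmDiff

/-! ## Griffiths monotonicity in the graph for the `+` boundary condition -/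

namespace Literature.Probability.LatticeModels

section PlusGraphMonotone

variable {V : Type*} [DecidableEq V]

/-- The endpoints inside `Λ` of a pair `e`. [folklore] -/
def endsIn (Λ : Finset V) (e : Sym2 V) : Finset V := e.toFinset.filter (· ∈ Λ)

/-- `endsIn Λ e ⊆ Λ`. [folklore] -/
theorem endsIn_subset (Λ : Finset V) (e : Sym2 V) : endsIn Λ e ⊆ Λ :=
  fun _ hx => (Finset.mem_filter.1 hx).2

/-- Under the `+` boundary condition the bond observable of a non-diagonal pair equals, on
glued configurations, the spin product of its endpoints inside `Λ` (the endpoints outside carry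
the boundary spin `+1`). [cite: FriedliVelenik2017, §3.1, eq. (3.2)] -/
theorem bondSpin_glue_plus (Λ : Finset V) (τ : Λ → ℤˣ) {e : Sym2 V} (he : ¬e.IsDiag) :
    bondSpin (glue Λ τ .plus) e = spinProduct (endsIn Λ e) (glue Λ τ .plus) := by
  induction e using Sym2.ind with
  | _ x y =>
    have hxy : x ≠ y := by rwa [Sym2.mk_isDiag_iff] at he
    have hout : ∀ z, z ∉ Λ → spinAt z (glue Λ τ .plus) = 1 := fun z hz => by
      simp [spinAt, glue_apply_of_notMem _ _ _ hz, BoundaryCondition.plus]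
    rw [bondSpin_mk, spinProduct]
    simp only [endsIn, Sym2.toFinset_mk_eq]
    rw [Finset.prod_filter, Finset.prod_pair hxy]
    by_cases hx : x ∈ Λ <;> by_cases hy : y ∈ Λ
    · simp [hx, hy]
    · simp [hx, hy, hout y hy]
    · simp [hx, hy, hout x hx]
    · simp [hx, hy, hout x hx, hout y hy]

/-- Edges touching `Λ` are monotone in the graph. [folklore] -/
theorem edgesTouching_mono_graph {G₁ G₂ : SimpleGraph V} [G₁.LocallyFinite] [G₂.LocallyFinite]
    (hle : G₁ ≤ G₂) (Λ : Finset V) : edgesTouching G₁ Λ ⊆ edgesTouching G₂ Λ := fun e he => by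
  rw [mem_edgesTouching_iff] at he ⊢
  exact ⟨SimpleGraph.edgeSet_subset_edgeSet.2 hle he.1, he.2⟩

omit [DecidableEq V] in
/-- `e^{β σ_B} = cosh β + σ_B sinh β` since `σ_B = ±1`. [folklore] -/
theorem exp_mul_spinProduct (β : ℝ) (B : Finset V) (σ : SpinConfig V) :
    Real.exp (β * spinProduct B σ) = Real.cosh β + Real.sinh β * spinProduct B σ := by
  rcases (abs_eq (zero_le_one)).1 (abs_spinProduct B σ) with h | h
  · rw [h, mul_one, mul_one, Real.cosh_add_sinh]
  · rw [h, mul_neg_one, mul_neg_one, ← sub_eq_add_neg, Real.cosh_sub_sinh]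

/-- **Change of graph as a tilt, `+` boundary condition.** For graphs `G₁ ≤ G₂`, with
`D = ℰ^b_Λ(G₂) ∖ ℰ^b_Λ(G₁)` and `W = ∏_{e ∈ D} e^{β σ_{e ∩ Λ}}` (`σ_{e ∩ Λ}` the product of the
spins at the endpoints of `e` inside `Λ`, the outside endpoint being a `+` boundary spin):
`⟨f⟩⁺_{Λ;G₂} ⟨W⟩⁺_{Λ;G₁} = ⟨f W⟩⁺_{Λ;G₁}`. [folklore] -/
theorem isingExpect_plus_mul_of_le {G₁ G₂ : SimpleGraph V} [G₁.LocallyFinite] [G₂.LocallyFinite]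
    (hle : G₁ ≤ G₂) (Λ : Finset V) (β h : ℝ) {f : SpinConfig V → ℝ} (hf : Measurable f) :
    isingExpect G₂ Λ β h .plus f *
        isingExpect G₁ Λ β h .plus
          (fun σ => ∏ e ∈ edgesTouching G₂ Λ \ edgesTouching G₁ Λ,
            Real.exp (β * spinProduct (endsIn Λ e) σ)) =
      isingExpect G₁ Λ β h .plus
        (fun σ => f σ * ∏ e ∈ edgesTouching G₂ Λ \ edgesTouching G₁ Λ,
          Real.exp (β * spinProduct (endsIn Λ e) σ)) := by
  set D := edgesTouching G₂ Λ \ edgesTouching G₁ Λ with hD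
  have hWm : Measurable fun σ : SpinConfig V => ∏ e ∈ D, Real.exp (β * spinProduct (endsIn Λ e) σ) :=
    Finset.measurable_prod _ fun e _ =>
      Real.measurable_exp.comp ((measurable_spinProduct _).const_mul β)
  have hDnd : ∀ e ∈ D, ¬e.IsDiag := fun e he =>
    SimpleGraph.not_isDiag_of_mem_edgeSet _ (mem_edgesTouching_iff.1 (Finset.mem_sdiff.1 he).1).1
  -- the Boltzmann weights differ by the factor `W`
  have hw : ∀ τ : Λ → ℤˣ, isingWeight G₂ Λ β h .plus τ =
      isingWeight G₁ Λ β h .plus τ *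
        ∏ e ∈ D, Real.exp (β * spinProduct (endsIn Λ e) (glue Λ τ .plus)) := by
    intro τ
    have hsplit : edgesTouching G₂ Λ = edgesTouching G₁ Λ ∪ D := by
      rw [hD, Finset.union_sdiff_of_subset (edgesTouching_mono_graph hle Λ)]
    have hdisj : Disjoint (edgesTouching G₁ Λ) D := by rw [hD]; exact Finset.disjoint_sdiff
    have hprod : ∏ e ∈ D, Real.exp (β * spinProduct (endsIn Λ e) (glue Λ τ .plus)) =
        Real.exp (β * ∑ e ∈ D, bondSpin (glue Λ τ .plus) e) := by
      rw [Finset.mul_sum, Real.exp_sum]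
      exact Finset.prod_congr rfl fun e he => by rw [bondSpin_glue_plus Λ τ (hDnd e he)]
    rw [hprod, isingWeight, isingWeight, ← Real.exp_add]
    congr 1
    have hE : interactionEdges G₂ Λ .plus = edgesTouching G₂ Λ := rfl
    have hE₁ : interactionEdges G₁ Λ .plus = edgesTouching G₁ Λ := rfl
    simp only [isingHamiltonian, hE, hE₁, hsplit, Finset.sum_union hdisj]
    ring
  rw [isingExpect_eq_sum_div G₂ Λ h .plus β hf, isingExpect_eq_sum_div G₁ Λ h .plus β hWm,
    isingExpect_eq_sum_div G₁ Λ h .plus β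
      (show Measurable (fun σ => f σ * ∏ e ∈ D, Real.exp (β * spinProduct (endsIn Λ e) σ)) from
        hf.mul hWm)]
  have hZ₁ := (isingPartitionFunction_pos G₁ Λ β h .plus).ne'
  have hZ₂ := (isingPartitionFunction_pos G₂ Λ β h .plus).ne'
  have hZ₂' : isingPartitionFunction G₂ Λ β h .plus =
      ∑ τ : Λ → ℤˣ, isingWeight G₁ Λ β h .plus τ *
        ∏ e ∈ D, Real.exp (β * spinProduct (endsIn Λ e) (glue Λ τ .plus)) := by
    unfold isingPartitionFunction
    exact Finset.sum_congr rfl fun τ _ => hw τ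
  rw [div_mul_div_comm, div_eq_div_iff (mul_ne_zero hZ₂ hZ₁) hZ₁]
  simp_rw [hw]
  rw [hZ₂'] at hZ₂ ⊢
  have : ∑ τ : Λ → ℤˣ, isingWeight G₁ Λ β h .plus τ *
      (∏ e ∈ D, Real.exp (β * spinProduct (endsIn Λ e) (glue Λ τ .plus))) * f (glue Λ τ .plus) =
      ∑ τ : Λ → ℤˣ, isingWeight G₁ Λ β h .plus τ *
        (f (glue Λ τ .plus) * ∏ e ∈ D, Real.exp (β * spinProduct (endsIn Λ e) (glue Λ τ .plus))) :=
    Finset.sum_congr rfl fun τ _ => by ring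
  rw [this]
  ring

/-- **Griffiths monotonicity in the graph for the `+` boundary condition** (Friedli–Velenik 2017,
Exercise 3.31 with Exercise 3.30: correlations are nondecreasing in nonnegative couplings and
fields; Griffiths 1967, Kelly–Sherman 1968): for graphs `G₁ ≤ G₂` on the same vertex set, `β ≥ 0`,
`h ≥ 0` and `A ⊆ Λ`, `⟨σ_A⟩⁺_{Λ;β,h}(G₁) ≤ ⟨σ_A⟩⁺_{Λ;β,h}(G₂)` — adding an edge inside `Λ` adds a
ferromagnetic coupling, adding an edge to the outside adds a nonnegative field. Proof:
`⟨σ_A⟩_{G₂}⟨W⟩_{G₁} = ⟨σ_A W⟩_{G₁} ≥ ⟨σ_A⟩_{G₁}⟨W⟩_{G₁}` by GKS II, expanding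
`W = ∏_{e ∈ D}(cosh β + σ_{e∩Λ} sinh β)` into spin products of subsets of `Λ` with nonnegative
coefficients. [cite: FriedliVelenik2017, Exercises 3.30–3.31] -/
theorem isingCorr_plus_mono_graph {G₁ G₂ : SimpleGraph V} [G₁.LocallyFinite] [G₂.LocallyFinite]
    (hle : G₁ ≤ G₂) {Λ A : Finset V} {β h : ℝ} (hβ : 0 ≤ β) (hh : 0 ≤ h) (hA : A ⊆ Λ) :
    isingCorr G₁ Λ β h .plus A ≤ isingCorr G₂ Λ β h .plus A := by
  set D := edgesTouching G₂ Λ \ edgesTouching G₁ Λ with hD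
  -- the tilt `W` and its expansion into spin products
  set W : SpinConfig V → ℝ := fun σ => ∏ e ∈ D, Real.exp (β * spinProduct (endsIn Λ e) σ) with hW
  have hWexp : W = fun σ => ∑ t ∈ D.powerset,
      (Real.cosh β ^ #t * Real.sinh β ^ #(D \ t)) *
        spinProduct ((D \ t).fold (fun s t : Finset V => s ∆ t) (∅ : Finset V) (endsIn Λ)) σ := by
    funext σ
    simp only [hW, exp_mul_spinProduct]
    rw [Finset.prod_add]
    refine Finset.sum_congr rfl fun t _ => ?_
    rw [Finset.prod_const, Finset.prod_mul_distrib, Finset.prod_const,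
      prod_spinProduct_eq_spinProduct_fold]
    ring
  have hWm : Measurable W :=
    Finset.measurable_prod _ fun e _ =>
      Real.measurable_exp.comp ((measurable_spinProduct _).const_mul β)
  have hWpos : 0 < isingExpect G₁ Λ β h .plus W :=
    isingExpect_pos G₁ Λ β h .plus hWm fun σ => Finset.prod_pos fun e _ => Real.exp_pos _
  have hkey := isingExpect_plus_mul_of_le hle Λ β h (measurable_spinProduct A)
  change isingCorr G₂ Λ β h .plus A * isingExpect G₁ Λ β h .plus W =
    isingExpect G₁ Λ β h .plus (fun σ => spinProduct A σ * W σ) at hkey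
  have hge : isingCorr G₁ Λ β h .plus A * isingExpect G₁ Λ β h .plus W ≤
      isingExpect G₁ Λ β h .plus (fun σ => spinProduct A σ * W σ) := by
    rw [hWexp]
    refine isingCorr_mul_isingExpect_sum_le G₁
      (fun Λ A B β h bc => GriffithsKellySherman.gks_two_holds G₁) hβ hh (Or.inr rfl) hA
      D.powerset _ _
      (fun t _ => mul_nonneg (pow_nonneg (Real.cosh_pos β).le _)
        (pow_nonneg (Real.sinh_nonneg_iff.2 hβ) _)) (fun t _ => ?_)
    exact (fold_symmDiff_subset_biUnion _ _).trans
      (Finset.biUnion_subset.2 fun e _ => endsIn_subset Λ e)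
  rw [← hkey] at hge
  exact le_of_mul_le_mul_right hge hWpos

end PlusGraphMonotone

/-! ## Expectations in the empty volume -/

section EmptyVolume

variable {V : Type*} [DecidableEq V] (G : SimpleGraph V) [G.LocallyFinite]

/-- In the empty volume every spin is a boundary spin: `⟨σ_y⟩⁺_{∅;β,h} = 1`. [folklore] -/
theorem isingExpect_plus_empty_spinAt (β h : ℝ) (y : V) :
    isingExpect G ∅ β h .plus (spinAt y) = 1 := by
  rw [isingExpect_eq_sum_div G ∅ h .plus β (measurable_spinAt y), isingPartitionFunction]
  have hval : ∀ τ : ↥(∅ : Finset V) → ℤˣ, spinAt y (glue ∅ τ .plus) = 1 := fun τ => by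
    simp [spinAt, BoundaryCondition.plus]
  simp only [hval, mul_one]
  exact div_self (isingPartitionFunction_pos G ∅ β h .plus).ne'

end EmptyVolume

end Literature.Probability.LatticeModels

/-! ## The slice embeddings `x' ↦ (x' with the value s inserted at coordinate i)` -/

namespace Literature.Barriers.CriticalPhenomena.NonGibbs

open MeasureTheory Finset Filter Topology Literature.Probability.LatticeModels

section Slice

variable (n : ℕ) (i : Fin (n + 1)) (s : ℤ)

/-- The slice embedding `ℤ^n ↪ ℤ^{n+1}` inserting the value `s` at coordinate `i` (for
`s = ±1` its image is the hyperplane `{y_i = s}` of internal sites through the neighbour `s e_i`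
of the origin — one of van Enter–Fernández–Sokal's "`(d-1)`-dimensional undiluted Ising models"
inside the diluted lattice). [cite: VanenterFernandezSokal1993, §4.3.1 Step 1] -/
def sliceEmb : Site n ↪ Site (n + 1) :=
  ⟨fun x => Fin.insertNth (α := fun _ : Fin (n + 1) => ℤ) i s x,
    fun _ _ h => (Fin.insertNth_injective2 (α := fun _ : Fin (n + 1) => ℤ) h).2⟩

/-- `sliceEmb` at the inserted coordinate. [cite: VanenterFernandezSokal1993, §4.3.1 Step 1] -/
@[simp] theorem sliceEmb_apply_same (x : Site n) : sliceEmb n i s x i = s :=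
  Fin.insertNth_apply_same (α := fun _ => ℤ) i s x

/-- `sliceEmb` at the other coordinates. [cite: VanenterFernandezSokal1993, §4.3.1 Step 1] -/
@[simp] theorem sliceEmb_apply_succAbove (x : Site n) (j : Fin n) :
    sliceEmb n i s x (i.succAbove j) = x j :=
  Fin.insertNth_apply_succAbove (α := fun _ => ℤ) i s x j

/-- Removing the inserted coordinate recovers the point. [cite: VanenterFernandezSokal1993, §4.3.1 Step 1] -/
@[simp] theorem removeNth_sliceEmb (x : Site n) :
    Fin.removeNth (α := fun _ : Fin (n + 1) => ℤ) i (sliceEmb n i s x) = x :=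
  funext fun j => sliceEmb_apply_succAbove n i s x j

/-- The unit vector along an inserted direction: `e_{i.succAbove j}` is `e_j` with a `0` inserted
at `i`. [folklore] -/
theorem single_succAbove (j : Fin n) (c : ℤ) :
    (Pi.single (i.succAbove j) c : Site (n + 1)) = Fin.insertNth (α := fun _ => ℤ) i 0 (Pi.single j c) := by
  symm
  refine Fin.insertNth_eq_iff.2 ⟨?_, ?_⟩
  · rw [Pi.single_apply, if_neg (Fin.succAbove_ne i j).symm]
  · funext k
    simp only [Fin.removeNth_apply, Pi.single_apply, Fin.succAbove_right_inj]

/-- `sliceEmb` is additive up to the inserted value. [folklore] -/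
theorem sliceEmb_add_single (x : Site n) (j : Fin n) :
    sliceEmb n i s (x + Pi.single j 1) = sliceEmb n i s x + Pi.single (i.succAbove j) 1 := by
  rw [single_succAbove]
  change Fin.insertNth (α := fun _ => ℤ) i s (x + Pi.single j 1) =
    Fin.insertNth (α := fun _ => ℤ) i s x + Fin.insertNth (α := fun _ => ℤ) i 0 (Pi.single j 1)
  rw [← Fin.insertNth_add, add_zero]

/-- The image of the origin is the neighbour `s e_i` of the origin. [cite: VanenterFernandezSokal1993, §4.3.1 Step 1] -/
theorem sliceEmb_zero : sliceEmb n i s 0 = Pi.single i s := by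
  change Fin.insertNth (α := fun _ => ℤ) i s 0 = Pi.single i s
  exact Fin.insertNth_zero_right (α := fun _ : Fin (n + 1) => ℤ) i s

/-- **The slice graph**: the nearest-neighbour edges of `ℤ^{n+1}` inside the hyperplane
`{y_i = s}`. [cite: VanenterFernandezSokal1993, §4.3.1 Step 1] -/
def sliceGraph : SimpleGraph (Site (n + 1)) where
  Adj a b := (zdGraph (n + 1)).Adj a b ∧ a i = s ∧ b i = s
  symm := ⟨fun _ _ h => ⟨h.1.symm, h.2.2, h.2.1⟩⟩
  loopless := ⟨fun a h => (zdGraph (n + 1)).loopless.1 a h.1⟩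

/-- Adjacency in the slice graph is decidable. [cite: VanenterFernandezSokal1993, §4.3.1 Step 1] -/
instance : DecidableRel (sliceGraph n i s).Adj := fun _ _ => Classical.dec _

/-- The slice graph is locally finite. [cite: VanenterFernandezSokal1993, §4.3.1 Step 1] -/
instance : (sliceGraph n i s).LocallyFinite := fun a =>
  Fintype.ofFinset
    (open Classical in ((zdGraph (n + 1)).neighborFinset a).filter fun b => a i = s ∧ b i = s)
    (by
      intro b
      simp only [Finset.mem_filter, SimpleGraph.mem_neighborFinset, SimpleGraph.mem_neighborSet]
      rfl)

/-- **The slice embedding is a local isomorphism**: adjacency of images in the slice graph is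
adjacency in `ℤ^n`. [cite: VanenterFernandezSokal1993, §4.3.1 Step 1] -/
theorem sliceGraph_adj_sliceEmb (x y : Site n) :
    (sliceGraph n i s).Adj (sliceEmb n i s x) (sliceEmb n i s y) ↔ (zdGraph n).Adj x y := by
  constructor
  · rintro ⟨hadj, -, -⟩
    obtain ⟨m, hm | hm⟩ := (zdGraph_adj_iff _ _).1 hadj
    · have hmi : m ≠ i := by
        intro hmi
        have := congr_fun hm i
        rw [hmi] at this
        simp at this
      obtain ⟨j, rfl⟩ := Fin.exists_succAbove_eq hmi
      refine (zdGraph_adj_iff x y).2 ⟨j, Or.inl ?_⟩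
      apply (sliceEmb n i s).injective
      rw [sliceEmb_add_single]
      exact hm
    · have hmi : m ≠ i := by
        intro hmi
        have := congr_fun hm i
        rw [hmi] at this
        simp at this
      obtain ⟨j, rfl⟩ := Fin.exists_succAbove_eq hmi
      refine (zdGraph_adj_iff x y).2 ⟨j, Or.inr ?_⟩
      apply (sliceEmb n i s).injective
      rw [sliceEmb_add_single]
      exact hm
  · intro hadj
    obtain ⟨j, hj | hj⟩ := (zdGraph_adj_iff x y).1 hadj
    · refine ⟨(zdGraph_adj_iff _ _).2 ⟨i.succAbove j, Or.inl ?_⟩, sliceEmb_apply_same _ _ _ _,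
        sliceEmb_apply_same _ _ _ _⟩
      rw [hj, sliceEmb_add_single]
    · refine ⟨(zdGraph_adj_iff _ _).2 ⟨i.succAbove j, Or.inr ?_⟩, sliceEmb_apply_same _ _ _ _,
        sliceEmb_apply_same _ _ _ _⟩
      rw [hj, sliceEmb_add_single]

/-- Every slice-neighbour of an image point is an image point.
[cite: VanenterFernandezSokal1993, §4.3.1 Step 1] -/
theorem sliceGraph_adj_sliceEmb_exists (x : Site n) (b : Site (n + 1))
    (h : (sliceGraph n i s).Adj (sliceEmb n i s x) b) : ∃ y, sliceEmb n i s y = b :=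
  ⟨Fin.removeNth (α := fun _ : Fin (n + 1) => ℤ) i b, by
    change Fin.insertNth (α := fun _ : Fin (n + 1) => ℤ) i s
      (Fin.removeNth (α := fun _ : Fin (n + 1) => ℤ) i b) = b
    rw [← h.2.2]
    exact Fin.insertNth_self_removeNth i b⟩

variable {n i s}

/-- For odd `s` the slice consists of internal sites, so the slice graph is a subgraph of the
decorated lattice ("`(d-1)`-dimensional … undiluted Ising models, ferromagnetically coupled" inside
the diluted system). [cite: VanenterFernandezSokal1993, §4.3.1 Step 1] -/
theorem sliceGraph_le_decoratedGraph (hs : ¬(2 : ℤ) ∣ s) :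
    sliceGraph n i s ≤ decoratedGraph (n + 1) := by
  intro a b h
  refine ⟨h.1, fun ha => hs ?_, fun hb => hs ?_⟩
  · simpa [h.2.1] using ha i
  · simpa [h.2.2] using hb i

/-- The image of the cube `box n (2L)` lies in `Λ^int_L` (`L ≥ 1`, `s = ±1`).
[cite: VanenterFernandezSokal1993, §4.3.1 Step 1] -/
theorem map_box_subset_gpiVolume' (hs : s = 1 ∨ s = -1) {L : ℕ} (hL : 1 ≤ L) :
    (box n (2 * L)).map (sliceEmb n i s) ⊆ gpiVolume' (n + 1) L := by
  intro a ha
  obtain ⟨x, hx, rfl⟩ := Finset.mem_map.1 ha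
  simp only [gpiVolume', Finset.mem_filter, mem_box]
  refine ⟨?_, fun himg => ?_⟩
  · intro k
    rcases Fin.eq_self_or_eq_succAbove i k with rfl | ⟨j, rfl⟩
    · rw [sliceEmb_apply_same]
      rcases hs with rfl | rfl <;> constructor <;> push_cast <;> omega
    · rw [sliceEmb_apply_succAbove]
      exact (mem_box.1 hx) j
  · have := himg i
    rw [sliceEmb_apply_same] at this
    rcases hs with rfl | rfl <;> omega

/-- No slice edge leaves the image of the cube inside `Λ^int_L`.
[cite: VanenterFernandezSokal1993, §4.3.1 Step 1] -/
theorem sliceGraph_separated (L : ℕ) :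
    ∀ a ∈ (box n (2 * L)).map (sliceEmb n i s),
      ∀ b ∈ gpiVolume' (n + 1) L \ (box n (2 * L)).map (sliceEmb n i s),
        ¬(sliceGraph n i s).Adj a b := by
  intro a ha b hb hab
  obtain ⟨x, -, rfl⟩ := Finset.mem_map.1 ha
  obtain ⟨y, rfl⟩ := sliceGraph_adj_sliceEmb_exists n i s x b hab
  obtain ⟨hbV, hbS⟩ := Finset.mem_sdiff.1 hb
  refine hbS (Finset.mem_map.2 ⟨y, ?_, rfl⟩)
  have hbox : sliceEmb n i s y ∈ box (n + 1) (2 * L) := (Finset.mem_filter.1 hbV).1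
  rw [mem_box] at hbox ⊢
  intro j
  have := hbox (i.succAbove j)
  rwa [sliceEmb_apply_succAbove] at this

end Slice

/-! ## Discharge of `VEFS1993_step24` -/

/-- **The `+` state of the `(d-1)`-dimensional model bounds the decorated `+` state from
below** (Griffiths' comparison, van Enter–Fernández–Sokal §4.3.1 Step 1): for `n ≥ 1`, `β ≥ 0`,
`s = ±1`, `L ≥ 1` and every coordinate `i`,
`⟨σ_{s e_i}⟩⁺_{dec; Λ^int_L} ≥ ⟨σ_0⟩⁺_{ℤ^n; box n (2L)}` — remove all edges off the slice
`{y_i = s}` (GKS II, `isingCorr_plus_mono_graph`), discard the now isolated sites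
(`isingExpect_fixed_eq_of_separated`), and transport along the slice embedding
(`isingExpect_plus_map_spinAt`). [cite: VanenterFernandezSokal1993, §4.3.1 Step 1] -/
theorem isingExpect_box_le_decorated {n : ℕ} (i : Fin (n + 1)) {s : ℤ} (hs : s = 1 ∨ s = -1)
    {β : ℝ} (hβ : 0 ≤ β) {L : ℕ} (hL : 1 ≤ L) :
    isingExpect (zdGraph n) (box n (2 * L)) β 0 .plus (spinAt 0) ≤
      isingExpect (decoratedGraph (n + 1)) (gpiVolume' (n + 1) L) β 0 .plus
        (spinAt (Pi.single i s)) := by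
  have hs2 : ¬(2 : ℤ) ∣ s := by rcases hs with rfl | rfl <;> decide
  set S : Finset (Site (n + 1)) := (box n (2 * L)).map (sliceEmb n i s) with hS
  have hSsub : S ⊆ gpiVolume' (n + 1) L := map_box_subset_gpiVolume' hs hL
  have hy : Pi.single i s = sliceEmb n i s 0 := (sliceEmb_zero n i s).symm
  have hyS : Pi.single i s ∈ S := by
    rw [hy]; exact Finset.mem_map_of_mem _ (zero_mem_box n _)
  -- transport along the slice embedding
  have htrans : isingExpect (sliceGraph n i s) S β 0 .plus (spinAt (Pi.single i s)) =
      isingExpect (zdGraph n) (box n (2 * L)) β 0 .plus (spinAt 0) := by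
    rw [hy]
    exact isingExpect_plus_map_spinAt (sliceEmb n i s)
      (fun x _ y => sliceGraph_adj_sliceEmb n i s x y)
      (fun x _ b hb => sliceGraph_adj_sliceEmb_exists n i s x b hb) β 0 0
  -- discard the sites of `Λ^int_L` off the slice
  have hsep : isingExpect (sliceGraph n i s) (gpiVolume' (n + 1) L) β 0 .plus (spinAt (Pi.single i s)) =
      isingExpect (sliceGraph n i s) S β 0 .plus (spinAt (Pi.single i s)) :=
    isingExpect_fixed_eq_of_separated (sliceGraph n i s) hSsub (sliceGraph_separated L) 1 β 0
      (measurable_spinAt _) fun σ σ' h => by simp only [spinAt, h _ hyS]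
  -- remove the edges off the slice
  have hmono : isingExpect (sliceGraph n i s) (gpiVolume' (n + 1) L) β 0 .plus (spinAt (Pi.single i s)) ≤
      isingExpect (decoratedGraph (n + 1)) (gpiVolume' (n + 1) L) β 0 .plus (spinAt (Pi.single i s)) := by
    have := isingCorr_plus_mono_graph (sliceGraph_le_decoratedGraph (n := n) (i := i) hs2) hβ le_rfl
      (Finset.singleton_subset_iff.2 (hSsub hyS)) (Λ := gpiVolume' (n + 1) L)
    simpa only [isingCorr, spinProduct_singleton] using this
  calc isingExpect (zdGraph n) (box n (2 * L)) β 0 .plus (spinAt 0)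
      = isingExpect (sliceGraph n i s) (gpiVolume' (n + 1) L) β 0 .plus (spinAt (Pi.single i s)) := by
        rw [hsep, htrans]
    _ ≤ _ := hmono

/-- **The finite-volume `+` magnetisation dominates the spontaneous magnetisation**:
`⟨σ_0⟩⁺_{box n L;β,0} ≥ m*_n(β)` for `β ≥ 0` (the `+` one-point function is nonincreasing in the
volume by GKS and converges to `m*`). [cite: FriedliVelenik2017, §3.7, Prop. 3.29 and Exercise 3.12] -/
theorem spontaneousMagnetization_le_isingExpect_box {n : ℕ} {β : ℝ} (hβ : 0 ≤ β) (L : ℕ) :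
    spontaneousMagnetization n β ≤ isingExpect (zdGraph n) (box n L) β 0 .plus (spinAt 0) := by
  have hlim := hasBoxLimit_isingCorr_plus_holds (d := n) hβ le_rfl {0}
  have hanti : Antitone fun L : ℕ => isingCorr (zdGraph n) (box n L) β 0 .plus {0} :=
    fun L₁ L₂ h => isingCorr_plus_le_of_subset (zdGraph n) hβ le_rfl
      (Finset.singleton_subset_iff.2 (zero_mem_box n L₁)) (box_mono n h)
  have := hanti.le_of_tendsto hlim L
  rw [spontaneousMagnetization_eq_plusCorr]
  simpa only [isingCorr, spinProduct_singleton] using this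

/-- **Discharge of `VEFS1993_step24`** (van Enter–Fernández–Sokal §4.3.1 Step 1 with Step 2.4):
for `d = n + 1 ≥ 3`, `β > β_c(n)` and a nearest neighbour `± e_i` of the origin,
`⟨σ_{±e_i}⟩⁺_{dec; Λ^int_L} ≥ ⟨σ_0⟩⁺_{ℤ^n; box n (2L)} ≥ m*_n(β) > 0` for `L ≥ 1` (the empty volume
`Λ^int_0` has `⟨σ⟩⁺ = 1`): the diluted system "is more ferromagnetic than the `(d-1)`-dimensional
undiluted Ising model, and hence exhibits spontaneous magnetization for all temperatures below
the critical temperature `J_{c,d-1}`". [cite: VanenterFernandezSokal1993, §4.3.1 Step 1 and Step 2.4] -/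
theorem VEFS1993_step24_holds : VEFS1993_step24 := by
  intro d hd β hβ
  obtain ⟨n, rfl⟩ : ∃ n, d = n + 1 := ⟨d - 1, by omega⟩
  have hn : 2 ≤ n := by omega
  simp only [Nat.add_sub_cancel] at hβ
  have hβ0 : 0 ≤ β := (criticalBeta_nonneg n).trans hβ.le
  have hmpos : 0 < spontaneousMagnetization n β :=
    spontaneousMagnetization_pos_of_criticalBeta_lt_holds (d := n) hn hβ
  have hmle : spontaneousMagnetization n β ≤ 1 := spontaneousMagnetization_le_one_holds (d := n) hβ0
  refine ⟨spontaneousMagnetization n β, hmpos, fun y hy L => ?_⟩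
  obtain ⟨i, hi | hi⟩ := (zdGraph_adj_zero_iff y).1 hy
  · rcases Nat.eq_zero_or_pos L with rfl | hL
    · have h0 : gpiVolume' (n + 1) 0 = ∅ := by
        refine Finset.eq_empty_iff_forall_notMem.2 fun z hz => ?_
        simp only [gpiVolume', Finset.mem_filter, mul_zero] at hz
        have hz0 : z = 0 := by
          funext k
          have := (mem_box.1 hz.1) k
          simp only [Nat.cast_zero, neg_zero, Pi.zero_apply] at this ⊢
          omega
        subst hz0
        exact hz.2 fun _ => dvd_zero 2
      rw [h0, isingExpect_plus_empty_spinAt]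
      exact hmle
    · rw [hi]
      exact (spontaneousMagnetization_le_isingExpect_box hβ0 (2 * L)).trans
        (isingExpect_box_le_decorated i (Or.inl rfl) hβ0 hL)
  · rcases Nat.eq_zero_or_pos L with rfl | hL
    · have h0 : gpiVolume' (n + 1) 0 = ∅ := by
        refine Finset.eq_empty_iff_forall_notMem.2 fun z hz => ?_
        simp only [gpiVolume', Finset.mem_filter, mul_zero] at hz
        have hz0 : z = 0 := by
          funext k
          have := (mem_box.1 hz.1) k
          simp only [Nat.cast_zero, neg_zero, Pi.zero_apply] at this ⊢
          omega
        subst hz0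
        exact hz.2 fun _ => dvd_zero 2
      rw [h0, isingExpect_plus_empty_spinAt]
      exact hmle
    · rw [hi, ← Pi.single_neg]
      exact (spontaneousMagnetization_le_isingExpect_box hβ0 (2 * L)).trans
        (isingExpect_box_le_decorated i (Or.inr rfl) hβ0 hL)

end Literature.Barriers.CriticalPhenomena.NonGibbs

end
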